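import Literature.NumberTheory.EllipticCurves.CMTorsionCartanMatrixProofs
import Literature.NumberTheory.GaloisRepresentations.SerreOpenImageGroupLemmas
import HarnessLib

/-!
# The split Cartan subgroup `𝔽_ℓ[√D]ˣ ⊂ GL₂(𝔽_ℓ)` from an ordinary inertia image and one
# anti-commuting element

Topic `NumberTheory/EllipticCurves`; theorems only (no definitions, no named facts).  The
*ordinary* companion of `CMTorsionCartanMatrixProofs` (pure `GL₂(𝔽_p)` group theory for the
Cartan-image clause (6) of the named fact
`Literature.NumberTheory.EllipticCurves.cmTorsion_cartanImage`, Lang, *Elliptic Functions*,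
Ch. 10 §4, read on `ℓ`-torsion).

Setting (`exists_commute_and_forall_exists_coe_conj_pow_eq`): `p > 3` prime, `Φ ∈ M₂(𝔽_p)`
non-scalar with `Φ² = D ≠ 0`; a set `S ⊆ GL₂(𝔽_p)` of elements commuting or anti-commuting with
`Φ` (the image of an inertia group above `ℓ`, inside the normaliser of the Cartan subgroup
`𝔽_p[Φ]ˣ` by Lang's Remark), having the *ordinary shape* of J.-P. Serre, Invent. Math. 15
(1972), §1.11, Prop. 11 and Cor.: a common eigenvector `v₀` with trivial action on
`𝔽_p² / 𝔽_p v₀` and every character value `a ∈ 𝔽_pˣ` on the line `𝔽_p v₀` attained; and one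
element `n₀` anti-commuting with `Φ` (complex conjugation).  Conclusion: some `s ∈ S` commutes
with `Φ`, and **every `a + bΦ` with `a² - D b² ≠ 0` is `n₀ s^m n₀⁻¹ s^k` for suitable
`m, k`** — the split Cartan subgroup `𝔽_p[Φ]ˣ ≅ 𝔽_pˣ × 𝔽_pˣ` is generated by the inertia
groups at the two primes `λ, λ̄` of the CM field above a split `ℓ` (Serre 1972, §4.5; Lang,
Ch. 10 §4, Thm. 8 with both components of the idele above `ℓ`).  Proof: take `s ∈ S` acting by a
generator `g₀` of `𝔽_pˣ` on `v₀`; in a basis `(w₀, v₀)` it is `diag(1, g₀)` (Serre 1972, §1.11,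
proof of the Cor.; the tree's `Serre1972.exists_conj_eq_halfDiagonalHom`); `s` cannot
anti-commute with `Φ` (that forces `g₀ = -1`), so `Φ` is diagonal in this basis, `= diag(λ, -λ)`
with `λ² = D`; `n₀` is then anti-diagonal and swaps the two eigenlines, so
`n₀ diag(1, u) n₀⁻¹ = diag(u, 1)`, and `a + bΦ = diag(a + bλ, a - bλ) = diag(g₀^m, 1)·diag(1, g₀^k)`.

## References

* [Serre1972] J.-P. Serre, *Propriétés galoisiennes des points d'ordre fini des courbes
  elliptiques*, Invent. Math. 15 (1972) 259–331: §1.11 (Prop. 11, Cor.), §2.1 a), §4.5.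
* [Lang1987] S. Lang, *Elliptic Functions*, 2nd ed., GTM 112 (1987), Ch. 10 §4 (Remark, Thm. 8).
-/

noncomputable section

open Matrix
open scoped MatrixGroups Classical

namespace Literature.NumberTheory.EllipticCurves

open Literature.NumberTheory.GaloisRepresentations
open Literature.NumberTheory.GaloisRepresentations.Serre1972
open Literature.NumberTheory.GaloisRepresentations.DeligneSerre1974

section Ordinary

variable {p : ℕ} [Fact p.Prime]

/-- A generator `g₀` of the cyclic group `𝔽_pˣ`, `p > 3`: every unit is a power of `g₀`, and
`g₀ ≠ 1`, `g₀² ≠ 1` (`g₀` has order `p - 1 > 2`). [folklore] -/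
theorem exists_generator_units_zmod (hp3 : 3 < p) :
    ∃ g₀ : (ZMod p)ˣ, (∀ u : (ZMod p)ˣ, ∃ n : ℕ, g₀ ^ n = u) ∧ g₀ ≠ 1 ∧ g₀ ^ 2 ≠ 1 := by
  obtain ⟨g₀, hg₀⟩ := IsCyclic.exists_generator (α := (ZMod p)ˣ)
  have hord : orderOf g₀ = p - 1 := by
    rw [orderOf_eq_card_of_forall_mem_zpowers hg₀, Nat.card_eq_fintype_card, ZMod.card_units]
  refine ⟨g₀, fun u ↦ (Submonoid.mem_powers_iff _ _).mp (mem_powers_iff_mem_zpowers.mpr (hg₀ u)), ?_, ?_⟩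
  · intro h1
    rw [h1, orderOf_one] at hord
    omega
  · intro h2
    have h := orderOf_dvd_of_pow_eq_one h2
    rw [hord] at h
    have := Nat.le_of_dvd two_pos h
    omega

/-- Conjugating a product relation: `(P⁻¹ x P)(P⁻¹ Φ P) = P⁻¹ (x Φ) P` and
`(P⁻¹ Φ P)(P⁻¹ x P) = P⁻¹ (Φ x) P` for `P ∈ GL₂`. [folklore] -/
theorem coe_conj_mul_conj {F : Type*} [Field F] (P x : GL (Fin 2) F) (Φ : Matrix (Fin 2) (Fin 2) F) :
    ((P⁻¹ * x * P : GL (Fin 2) F) : Matrix (Fin 2) (Fin 2) F) *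
        (((P⁻¹ : GL (Fin 2) F) : Matrix (Fin 2) (Fin 2) F) * Φ * (P : Matrix (Fin 2) (Fin 2) F)) =
      ((P⁻¹ : GL (Fin 2) F) : Matrix (Fin 2) (Fin 2) F) * ((x : Matrix (Fin 2) (Fin 2) F) * Φ) *
        (P : Matrix (Fin 2) (Fin 2) F) ∧
    ((P⁻¹ : GL (Fin 2) F) : Matrix (Fin 2) (Fin 2) F) * Φ * (P : Matrix (Fin 2) (Fin 2) F) *
        ((P⁻¹ * x * P : GL (Fin 2) F) : Matrix (Fin 2) (Fin 2) F) =
      ((P⁻¹ : GL (Fin 2) F) : Matrix (Fin 2) (Fin 2) F) * (Φ * (x : Matrix (Fin 2) (Fin 2) F)) *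
        (P : Matrix (Fin 2) (Fin 2) F) := by
  constructor <;>
    simp only [Units.val_mul, mul_assoc, Units.mul_inv_cancel_left]

/-- **The split Cartan subgroup generated by an ordinary inertia image and its conjugate by an
anti-commuting element** (Serre 1972, §4.5 with §1.11 Prop. 11 and Cor.; Lang, Ch. 10 §4, Thm. 8
read at both primes above a split `ℓ`).  Let `p > 3`, `Φ ∈ M₂(𝔽_p)` non-scalar with
`Φ² = D ≠ 0`, `S ⊆ GL₂(𝔽_p)` a set of elements each commuting or anti-commuting with `Φ`, with a
common vector `v₀ ≠ 0` such that every `g ∈ S` acts trivially on `𝔽_p²/𝔽_p v₀` and every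
`a ∈ 𝔽_pˣ` is the eigenvalue on `v₀` of some `g ∈ S`; let `n₀` anti-commute with `Φ`.  Then some
`s ∈ S` commutes with `Φ` and for all `a, b` with `a² - D b² ≠ 0` there are `m, k` with
`a + bΦ = n₀ s^m n₀⁻¹ s^k`. [cite: Serre1972, §4.5 and §1.11 (Prop. 11, Cor.)] -/
theorem exists_commute_and_forall_exists_coe_conj_pow_eq (hp3 : 3 < p)
    {Φ : Matrix (Fin 2) (Fin 2) (ZMod p)} {D : ZMod p}
    (hΦ : Φ * Φ = D • (1 : Matrix (Fin 2) (Fin 2) (ZMod p))) (hD : D ≠ 0)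
    (hns : ∀ c : ZMod p, Φ ≠ c • 1)
    {v₀ : Fin 2 → ZMod p} (hv₀ : v₀ ≠ 0) (S : Set (GL (Fin 2) (ZMod p)))
    (hSN : ∀ g ∈ S, Φ * (g : Matrix (Fin 2) (Fin 2) (ZMod p)) = (g : Matrix (Fin 2) (Fin 2) (ZMod p)) * Φ ∨
      Φ * (g : Matrix (Fin 2) (Fin 2) (ZMod p)) = -((g : Matrix (Fin 2) (Fin 2) (ZMod p)) * Φ))
    (hquot : ∀ g ∈ S, ∀ w : Fin 2 → ZMod p, ∃ b : ZMod p,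
      (g : Matrix (Fin 2) (Fin 2) (ZMod p)) *ᵥ w - w = b • v₀)
    (honto : ∀ a : (ZMod p)ˣ, ∃ g ∈ S,
      (g : Matrix (Fin 2) (Fin 2) (ZMod p)) *ᵥ v₀ = (a : ZMod p) • v₀)
    {n₀ : GL (Fin 2) (ZMod p)}
    (hn₀ : Φ * (n₀ : Matrix (Fin 2) (Fin 2) (ZMod p)) = -((n₀ : Matrix (Fin 2) (Fin 2) (ZMod p)) * Φ)) :
    ∃ s ∈ S, Φ * (s : Matrix (Fin 2) (Fin 2) (ZMod p)) = (s : Matrix (Fin 2) (Fin 2) (ZMod p)) * Φ ∧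
      ∀ a b : ZMod p, a ^ 2 - D * b ^ 2 ≠ 0 → ∃ m k : ℕ,
        a • (1 : Matrix (Fin 2) (Fin 2) (ZMod p)) + b • Φ =
          ((n₀ * s ^ m * n₀⁻¹ * s ^ k : GL (Fin 2) (ZMod p)) : Matrix (Fin 2) (Fin 2) (ZMod p)) := by
  have hp2 : p ≠ 2 := by omega
  haveI : NeZero (2 : ZMod p) := ⟨two_ne_zero_of_ne_two hp2⟩
  obtain ⟨g₀, hgen, hg1, hg2⟩ := exists_generator_units_zmod hp3
  obtain ⟨s, hsS, hsv⟩ := honto g₀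
  -- diagonalise `s`: `P⁻¹ s P = diag(1, g₀)`
  obtain ⟨P, -, hPs⟩ := exists_conj_eq_halfDiagonalHom hv₀ hg1 hsv (hquot s hsS)
  set Φ' : Matrix (Fin 2) (Fin 2) (ZMod p) :=
    ((P⁻¹ : GL (Fin 2) (ZMod p)) : Matrix (Fin 2) (Fin 2) (ZMod p)) * Φ *
      (P : Matrix (Fin 2) (Fin 2) (ZMod p)) with hΦ'
  set d : Fin 2 → ZMod p := ![1, ((g₀ : (ZMod p)ˣ) : ZMod p)] with hd
  have hPP : (P : Matrix (Fin 2) (Fin 2) (ZMod p)) *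
      ((P⁻¹ : GL (Fin 2) (ZMod p)) : Matrix (Fin 2) (Fin 2) (ZMod p)) = 1 := by
    rw [← Units.val_mul, mul_inv_cancel, Units.val_one]
  have hPP' : ((P⁻¹ : GL (Fin 2) (ZMod p)) : Matrix (Fin 2) (Fin 2) (ZMod p)) *
      (P : Matrix (Fin 2) (Fin 2) (ZMod p)) = 1 := by
    rw [← Units.val_mul, inv_mul_cancel, Units.val_one]
  have hs' : ((P⁻¹ * s * P : GL (Fin 2) (ZMod p)) : Matrix (Fin 2) (Fin 2) (ZMod p)) = diagonal d := by
    rw [hPs, coe_halfDiagonalHom]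
  -- `Φ'² = D`, `Φ'` non-scalar
  have hΦ'sq : Φ' * Φ' = D • (1 : Matrix (Fin 2) (Fin 2) (ZMod p)) := by
    have h1 : Φ' * Φ' = ((P⁻¹ : GL (Fin 2) (ZMod p)) : Matrix (Fin 2) (Fin 2) (ZMod p)) * (Φ * Φ) *
        (P : Matrix (Fin 2) (Fin 2) (ZMod p)) := by
      simp only [hΦ', mul_assoc, Units.mul_inv_cancel_left]
    rw [h1, hΦ, Matrix.mul_smul, Matrix.mul_one, Matrix.smul_mul, hPP']
  have hns' : ∀ c : ZMod p, Φ' ≠ c • 1 := by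
    intro c hc
    apply hns c
    have h1 : Φ = (P : Matrix (Fin 2) (Fin 2) (ZMod p)) * Φ' *
        ((P⁻¹ : GL (Fin 2) (ZMod p)) : Matrix (Fin 2) (Fin 2) (ZMod p)) := by
      simp only [hΦ', mul_assoc, Units.mul_inv_cancel_left, Units.mul_inv, mul_one]
    rw [h1, hc, Matrix.mul_smul, Matrix.mul_one, Matrix.smul_mul, hPP]
  -- the relation between `diag(1, g₀)` and `Φ'`
  obtain ⟨e1, e2⟩ := coe_conj_mul_conj P s Φ
  rw [hs'] at e1 e2
  have hd0 : d 0 ≠ 0 := by simp [hd]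
  have hd1 : d 1 ≠ 0 := by simp [hd]
  have hd01 : d 0 ≠ d 1 := by
    simp only [hd, Matrix.cons_val_zero, Matrix.cons_val_one]
    intro h
    exact hg1 (Units.ext h.symm)
  -- `s` commutes with `Φ` (otherwise `g₀ = -1`)
  have hcomm : Φ * (s : Matrix (Fin 2) (Fin 2) (ZMod p)) = (s : Matrix (Fin 2) (Fin 2) (ZMod p)) * Φ := by
    rcases hSN s hsS with h | h
    · exact h
    · exfalso
      have hanti : Φ' * diagonal d = -(diagonal d * Φ') := by
        rw [e1, e2, h, Matrix.mul_neg, Matrix.neg_mul]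
      have had : GL2.IsAd Φ' := GL2.isAd_of_anticommute_diagonal hd0 hd1 hanti
      have h01 : Φ' 0 1 ≠ 0 := by
        intro h0
        have hsq := had.mul_self
        rw [hΦ'sq, h0, zero_mul] at hsq
        apply hD
        have := congrFun (congrFun hsq 0) 0
        simpa using this
      have hneg := GL2.entry_eq_neg_of_anticommute_diagonal h01 hanti
      simp only [hd, Matrix.cons_val_zero, Matrix.cons_val_one] at hneg
      apply hg2
      apply Units.ext
      rw [Units.val_pow_eq_pow_val, hneg, Units.val_one]
      ring
  have hcomm' : Φ' * diagonal d = diagonal d * Φ' := by rw [e1, e2, hcomm]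
  -- `Φ' = diag(λ, -λ)`, `λ² = D`, `λ ≠ 0`
  have hdg : GL2.IsDg Φ' := GL2.isDg_of_commute_diagonal hd01 hcomm'
  set l : ZMod p := Φ' 0 0 with hl
  have hΦ'eq : Φ' = diagonal ![l, Φ' 1 1] := hdg.eq_diagonal
  have hl2 : l * l = D := by
    have := congrFun (congrFun hΦ'sq 0) 0
    rw [hΦ'eq] at this
    simpa [Matrix.mul_apply, Fin.sum_univ_two, diagonal] using this
  have hm2 : Φ' 1 1 * Φ' 1 1 = D := by
    have := congrFun (congrFun hΦ'sq 1) 1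
    rw [hΦ'eq] at this
    simpa [Matrix.mul_apply, Fin.sum_univ_two, diagonal] using this
  have hμ : Φ' 1 1 = -l := by
    have hne : Φ' 1 1 ≠ l := by
      intro he
      apply hns' l
      rw [hΦ'eq, he]
      ext i j
      fin_cases i <;> fin_cases j <;> simp [diagonal]
    have h0 : (Φ' 1 1 - l) * (Φ' 1 1 + l) = 0 := by linear_combination hm2 - hl2
    rcases mul_eq_zero.mp h0 with h | h
    · exact absurd (sub_eq_zero.mp h) hne
    · exact eq_neg_of_add_eq_zero_left h
  have hl0 : l ≠ 0 := by
    intro h0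
    apply hD
    rw [← hl2, h0, zero_mul]
  have hΦ'd : Φ' = diagonal ![l, -l] := by rw [hΦ'eq, hμ]
  -- `n₀' = P⁻¹ n₀ P` is anti-diagonal
  set n₀' : GL (Fin 2) (ZMod p) := P⁻¹ * n₀ * P with hn₀'
  obtain ⟨f1, f2⟩ := coe_conj_mul_conj P n₀ Φ
  have hn₀'anti : (n₀' : Matrix (Fin 2) (Fin 2) (ZMod p)) * diagonal ![l, -l] =
      -(diagonal ![l, -l] * (n₀' : Matrix (Fin 2) (Fin 2) (ZMod p))) := by
    rw [← hΦ'd, hn₀', f1, f2, hn₀, Matrix.mul_neg, Matrix.neg_mul, neg_neg]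
  have hn₀'ad : GL2.IsAd (n₀' : Matrix (Fin 2) (Fin 2) (ZMod p)) :=
    GL2.isAd_of_anticommute_diagonal (d := ![l, -l]) (by simpa using hl0) (by simpa using hl0) hn₀'anti
  have hswap : ∀ u : ZMod p, (n₀' : Matrix (Fin 2) (Fin 2) (ZMod p)) * diagonal ![1, u] =
      diagonal ![u, 1] * (n₀' : Matrix (Fin 2) (Fin 2) (ZMod p)) := by
    intro u
    ext i j
    fin_cases i <;> fin_cases j <;>
      simp [Matrix.mul_apply, diagonal, hn₀'ad.1, hn₀'ad.2, mul_comm]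
  -- powers of `s` in the new basis
  have hspow : ∀ n : ℕ, ((P⁻¹ * s ^ n * P : GL (Fin 2) (ZMod p)) : Matrix (Fin 2) (Fin 2) (ZMod p)) =
      diagonal ![1, ((g₀ ^ n : (ZMod p)ˣ) : ZMod p)] := by
    intro n
    have hc : P⁻¹ * s ^ n * P = (P⁻¹ * s * P) ^ n := by
      have h := (conj_pow : (P⁻¹ * s * P⁻¹⁻¹) ^ n = P⁻¹ * s ^ n * P⁻¹⁻¹)
      rw [inv_inv] at h
      exact h.symm
    rw [hc, hPs, ← map_pow, coe_halfDiagonalHom]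
  refine ⟨s, hsS, hcomm, fun a b hab ↦ ?_⟩
  -- the two eigenvalues `a ± bλ` are units, hence powers of `g₀`
  have hu12 : (a + b * l) * (a - b * l) = a ^ 2 - D * b ^ 2 := by rw [← hl2]; ring
  have hu1 : a + b * l ≠ 0 := fun h ↦ hab (by rw [← hu12, h, zero_mul])
  have hu2 : a - b * l ≠ 0 := fun h ↦ hab (by rw [← hu12, h, mul_zero])
  obtain ⟨m, hm⟩ := hgen (Units.mk0 _ hu1)
  obtain ⟨k, hk⟩ := hgen (Units.mk0 _ hu2)
  refine ⟨m, k, ?_⟩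
  have hGL : n₀ * s ^ m * n₀⁻¹ * s ^ k =
      P * (n₀' * (P⁻¹ * s ^ m * P) * n₀'⁻¹ * (P⁻¹ * s ^ k * P)) * P⁻¹ := by
    simp only [hn₀']
    group
  have hmid : ((n₀' * (P⁻¹ * s ^ m * P) * n₀'⁻¹ * (P⁻¹ * s ^ k * P) : GL (Fin 2) (ZMod p)) :
      Matrix (Fin 2) (Fin 2) (ZMod p)) = diagonal ![a + b * l, a - b * l] := by
    calc ((n₀' * (P⁻¹ * s ^ m * P) * n₀'⁻¹ * (P⁻¹ * s ^ k * P) : GL (Fin 2) (ZMod p)) :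
          Matrix (Fin 2) (Fin 2) (ZMod p))
        = (n₀' : Matrix (Fin 2) (Fin 2) (ZMod p)) * diagonal ![1, a + b * l] *
            ((n₀'⁻¹ : GL (Fin 2) (ZMod p)) : Matrix (Fin 2) (Fin 2) (ZMod p)) *
            diagonal ![1, a - b * l] := by
          rw [Units.val_mul, Units.val_mul, Units.val_mul, hspow m, hspow k, hm, hk, Units.val_mk0,
            Units.val_mk0]
      _ = diagonal ![a + b * l, 1] * ((n₀' : Matrix (Fin 2) (Fin 2) (ZMod p)) *
            ((n₀'⁻¹ : GL (Fin 2) (ZMod p)) : Matrix (Fin 2) (Fin 2) (ZMod p))) *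
            diagonal ![1, a - b * l] := by rw [hswap, Matrix.mul_assoc (diagonal _)]
      _ = diagonal ![a + b * l, a - b * l] := by
          rw [← Units.val_mul, mul_inv_cancel, Units.val_one, Matrix.mul_one, diagonal_mul_diagonal]
          congr 1
          ext i
          fin_cases i <;> simp
  have hdiag : diagonal ![a + b * l, a - b * l] = a • (1 : Matrix (Fin 2) (Fin 2) (ZMod p)) + b • Φ' := by
    rw [hΦ'd]
    ext i j
    fin_cases i <;> fin_cases j <;> simp [diagonal]
    ring
  rw [hGL, Units.val_mul, Units.val_mul, hmid, hdiag]
  simp only [hΦ', Matrix.mul_add, Matrix.add_mul, Matrix.mul_smul, Matrix.smul_mul, mul_one, mul_assoc,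
    Units.mul_inv_cancel_left, Units.mul_inv]

end Ordinary

end Literature.NumberTheory.EllipticCurves

end
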